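import Literature.MathematicalPhysics.QuantumFieldTheory.Balaban1983to89.B3OddVectorLoopsVanish
import Literature.MathematicalPhysics.QuantumFieldTheory.Balaban1983to89.B3Sect2ThreeLegGraphs
import Literature.MathematicalPhysics.QuantumFieldTheory.Balaban1983to89.B3Sect3LowestOrderGraphs

/-!
# `Balaban1983to89.B3ThreeLegSurplusVanish` — T. Bałaban, *(Higgs)₂,₃ quantum fields in a finite volume. III. Renormalization*,
Commun. Math. Phys. **88** (1983) 411–445 [Balaban1983Higgs3]: p. 430 *"In fact the only other divergent graphs of this class are:
(a)–(g) (2.21) and permuted graphs"* and p. 438 *"There are only two such graphs (3.21)"* — the SURPLUS graphs of the concrete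
model (HOME/GAPS.md G-B3-03: X1, X2; G-B3-05: the third (3.21)-type graph) have VANISHING internal-index weight, by the mechanism
print itself invokes on p. 434 (*"at least one loop of scalar field lines with an odd number of vector field legs, thus with an odd
power of q, and we have tr q^{2n+1} = 0"*) and on p. 442 (*"the expression corresponding to the graph (2.21a) vanishes"*)

statement-level skeleton of published theorems with citation tags; proofs where landed; nothing here is a claim about the Yang–Mills mass gap

PDF held: `paper:balaban1983-higgs-2-3-quantum-fields-finite-volume` (journal page = PDF page + 410); text layer p0020/p0024/p0028
read; render `…/b2b-balaban-ref1/pages/1983-cmp88-higgs23-III/1983-cmp88-higgs23-III-p020-x2.png` (p. 430).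
CITATION HEADER (lean-in-tree rule).  lit-balaban TYPED SKELETON (HOME `run/shared/lean/pub/lit-balaban/`), reader/typer seat r15
(gen 15), unit `lit-balaban-r15`, fold owner of SKELETON rows **B3.Eq2.18-2.22** (pp. 429–430) and **B3.Eq3.21-3.24** (pp. 438–439).
This file is the CONDITION (κ) of lead g11's HEAD WORD Q16 (HOME/STATUS 2026-08-23T05:27:29Z): *"a located member certifying that
the expression ∕ `indexWeight` of `gX1` and of `gX2` vanishes on the model — for X2 an instance of
`B3IndexNetworks.eval_eq_zero_of_odd_closed` (p250872) on its odd tadpole loop, for X1 the antisymmetric-form identity on the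
zero-background carrier (or the odd-line instance if that is how the model evaluates it)"*, with the lead's READING RULE FOR
PICTORIAL ENUMERATIONS (c): every surplus member of the model's class carries a kernel-checked certificate that its internal-index
weight vanishes identically, by a mechanism print invokes for graphs of that kind; and the PARITY NOTE inviting the same certificate
for `g321Y` (G-B3-05).

THE GRAPHS (all typed by seat p18 on the concrete model `B3Cor23Concrete`; nothing restated).  `B3Sect2ThreeLegGraphs.gX1` (p248628):
(1.8)_{0,1} (vertex 0) doubly φ′-linked to (1.6) (vertex 1) — its legs 0, 1 end on the legs 0, 1 of (1.6), i.e. on ONE bilinear form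
(φ′·φ′) of the φ⁴ vertex; external: the legs 2, 3 of (1.6) and the Ã-leg.  `gX2` (p248628): (1.8)_{0,1} –φ′– (1.8)_{1,0} –A′– (1.8)_{1,0}
(vertex 2) whose two φ′-legs form a tadpole.  `B3Sect3LowestOrderGraphs.g321Y` (p248264): two (1.8)_{1,0} joined by the A′-line, the
φ′-legs of vertex 0 joined to each other.  `g221a` (print's own (2.21a), p. 430): (1.8)_{1,0} (vertex 0) with a φ′-tadpole –A′–
(1.10)_{1,1}.  In each case the index network (`B3OddVectorLoopsVanish.indexNet`: one strand edge per bilinear form carrying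
q^{n+n′}, one line edge per scalar line carrying q⁰) contains a CLOSED LOOP of degree-2 nodes carrying total power 1 of q:
the tadpole {leg 0, leg 1} of the (1.8)_{1,0} vertex (X2, g321Y, (2.21a)), resp. the square {(1.8).0, (1.8).1, (1.6).0, (1.6).1}
(X1: strand of (1.8)_{0,1} with q¹, strand (φ′·φ′) of (1.6) with q⁰, two lines) — so the model evaluates X1, too, by the odd-loop
instance (the lead's parenthesis); the external φ′-legs elsewhere in the graph do not touch the loop.

WHAT IS PROVED (sorry-free, theorems only, no `Prop` fact): for every order n̄ ≥ 1 (≥ 2 where the vertex (1.10)_{1,1} needs it),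
every N ≥ 1 and every antisymmetric charge matrix q, `indexWeight G q = 0` for G = `gX1`, `gX2` (G-B3-03), `g321Y` (G-B3-05) and
`g221a` ((2.21a), p. 442) — `indexWeight_gX1_eq_zero`, `indexWeight_gX2_eq_zero`, `indexWeight_g321Y_eq_zero`,
`indexWeight_g221a_eq_zero` — each as `B3IndexNetworks.eval_eq_zero_of_odd_closed` applied to the explicit loop, the three
hypotheses (closed, degree 2, odd power) DECIDED by the kernel (`decide`) on the closed instance n̄ = 1 and transferred to every
n̄ definitionally (n̄ enters p18's graphs only through the admissibility proofs, so the index networks are the same term);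
`surplus_vanish` packages the two G-B3-03 certificates.  Honest scope: `indexWeight` sums over the indices of ALL φ′-legs (external ones included, see its docstring); the
vanishing here comes from the internal loop alone, whatever is done with the external indices.
-/

namespace Literature.MathematicalPhysics.QuantumFieldTheory.Balaban1983to89.B3ThreeLegSurplusVanish

open Finset B3Prop1 B3Cor23Concrete B3DivergentGraphs B3OddVectorLoops B3IndexNetworks B3OddVectorLoopsVanish
  B3Sect2ThreeLegGraphs B3Sect3LowestOrderGraphs

variable {nbar : ℕ} {n : Type*} [Fintype n] [DecidableEq n] [Nonempty n]

/-- **G-B3-03, X2** (p. 430 enumeration (2.21), surplus model graph `B3Sect2ThreeLegGraphs.gX2`): its internal-index weight VANISHES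
for every N ≥ 1 and every antisymmetric q — the φ′-tadpole {leg 0, leg 1} of its third vertex (1.8)_{1,0} is a closed loop of
degree-2 nodes of the index network carrying the odd power q¹ (p. 434 mechanism; `B3IndexNetworks.eval_eq_zero_of_odd_closed`).
[cite: Balaban1983Higgs3, (2.21) p.430] -/
theorem indexWeight_gX2_eq_zero (hn : 1 ≤ nbar) (q : Matrix n n ℝ) (hq : q.transpose = -q) :
    indexWeight (gX2 nbar hn) q = 0 := by
  -- the three hypotheses are decided by the kernel on the closed instance n̄ = 1; the index network does not depend on n̄
  -- (n̄ enters `gX2 n̄ hn` only through the admissibility proofs), so the instance transfers definitionally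
  have h : indexWeight (gX2 1 le_rfl) q = 0 :=
    eval_eq_zero_of_odd_closed q hq (indexNet (gX2 1 le_rfl))
      ({⟨⟨2, Nat.lt_succ_self 2⟩, ⟨0, Nat.succ_pos 1⟩⟩, ⟨⟨2, Nat.lt_succ_self 2⟩, ⟨1, Nat.lt_succ_self 1⟩⟩} : Finset (SLeg (gX2 1 le_rfl)))
      (by decide) (by decide) (by decide)
  exact h

/-- **G-B3-03, X1** (surplus model graph `B3Sect2ThreeLegGraphs.gX1`): its internal-index weight VANISHES for every N ≥ 1 and every
antisymmetric q — the square {(1.8)₀,₁.0, (1.8)₀,₁.1, (1.6).0, (1.6).1} (the strand of (1.8)_{0,1} with q¹, the strand (φ′·φ′) of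
(1.6) with q⁰, the two scalar lines) is a closed loop of degree-2 nodes carrying the odd power q¹; the external legs 2, 3 of (1.6)
are off the loop (the odd-line instance of the lead's word; `eval_eq_zero_of_odd_closed`). [cite: Balaban1983Higgs3, (2.21) p.430] -/
theorem indexWeight_gX1_eq_zero (hn : 1 ≤ nbar) (q : Matrix n n ℝ) (hq : q.transpose = -q) :
    indexWeight (gX1 nbar hn) q = 0 := by
  have h : indexWeight (gX1 1 le_rfl) q = 0 :=
    eval_eq_zero_of_odd_closed q hq (indexNet (gX1 1 le_rfl))
      ({⟨⟨0, Nat.succ_pos 1⟩, ⟨0, Nat.succ_pos 1⟩⟩, ⟨⟨0, Nat.succ_pos 1⟩, ⟨1, Nat.lt_succ_self 1⟩⟩,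
          ⟨⟨1, Nat.lt_succ_self 1⟩, ⟨0, Nat.succ_pos 3⟩⟩, ⟨⟨1, Nat.lt_succ_self 1⟩, ⟨1, Nat.lt_of_sub_eq_succ rfl⟩⟩} :
        Finset (SLeg (gX1 1 le_rfl)))
      (by decide) (by decide) (by decide)
  exact h

/-- **G-B3-05** (p. 438 *"There are only two such graphs (3.21)"*, surplus model graph `B3Sect3LowestOrderGraphs.g321Y`; lead g11's
PARITY NOTE at Q16): its internal-index weight VANISHES for every N ≥ 1 and every antisymmetric q — the φ′-tadpole {leg 0, leg 1}
of its first vertex (1.8)_{1,0} carries the odd power q¹ (p. 434 mechanism). [cite: Balaban1983Higgs3, (3.21) p.438] -/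
theorem indexWeight_g321Y_eq_zero (hn : 1 ≤ nbar) (q : Matrix n n ℝ) (hq : q.transpose = -q) :
    indexWeight (g321Y nbar hn) q = 0 := by
  have h : indexWeight (g321Y 1 le_rfl) q = 0 :=
    eval_eq_zero_of_odd_closed q hq (indexNet (g321Y 1 le_rfl))
      ({⟨⟨0, Nat.succ_pos 1⟩, ⟨0, Nat.succ_pos 1⟩⟩, ⟨⟨0, Nat.succ_pos 1⟩, ⟨1, Nat.lt_succ_self 1⟩⟩} : Finset (SLeg (g321Y 1 le_rfl)))
      (by decide) (by decide) (by decide)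
  exact h

/-- **(2.21a)** p. 430 / p. 442 *"the expression corresponding to the graph (2.21a) vanishes"* — on the model graph
`B3Sect2ThreeLegGraphs.g221a` (print's own picture, the sibling of X2): its internal-index weight VANISHES for every N ≥ 1 and every
antisymmetric q — the φ′-tadpole {leg 0, leg 1} of its vertex (1.8)_{1,0} carries the odd power q¹ (p. 434 mechanism).
[cite: Balaban1983Higgs3, (2.21) p.430] -/
theorem indexWeight_g221a_eq_zero (hn : 1 ≤ nbar) (q : Matrix n n ℝ) (hq : q.transpose = -q) :
    indexWeight (g221a nbar hn) q = 0 := by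
  have h : indexWeight (g221a 1 le_rfl) q = 0 :=
    eval_eq_zero_of_odd_closed q hq (indexNet (g221a 1 le_rfl))
      ({⟨⟨0, Nat.succ_pos 1⟩, ⟨0, Nat.succ_pos 1⟩⟩, ⟨⟨0, Nat.succ_pos 1⟩, ⟨1, Nat.lt_succ_self 1⟩⟩} : Finset (SLeg (g221a 1 le_rfl)))
      (by decide) (by decide) (by decide)
  exact h

/-- **G-B3-03 adjudicated (lead g11, Q16, reading (i))**: both surplus members X1, X2 of the model's class «two external scalar legs
+ one external vector leg, D ≤ 0» have vanishing internal-index weight for every N ≥ 1 and every antisymmetric q — so, in print's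
usage of p. 434 (a graph whose expression vanishes identically is no divergent graph), the printed list (2.18)–(2.21) «and permuted
graphs» is complete on the model. [cite: Balaban1983Higgs3, (2.21) p.430] -/
theorem surplus_vanish (hn : 1 ≤ nbar) (q : Matrix n n ℝ) (hq : q.transpose = -q) :
    indexWeight (gX1 nbar hn) q = 0 ∧ indexWeight (gX2 nbar hn) q = 0 :=
  ⟨indexWeight_gX1_eq_zero hn q hq, indexWeight_gX2_eq_zero hn q hq⟩

end Literature.MathematicalPhysics.QuantumFieldTheory.Balaban1983to89.B3ThreeLegSurplusVanish
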